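import Summits.BirchSwinnertonDyer.BirchSwinnertonDyer.Theorems.SignedLowerHalvesKobayashiLowerHalfLargeImageTwistToLocusPotMult
import Literature.NumberTheory.EllipticCurves.ComplexMultiplicationShaKnappProofs
import HarnessLib

/-!
# Route `SignedLowerHalves`, crux `KobayashiLowerHalfLargeImage` (item stmt-BirchSwinnertonDyer-19001):
# TWIST-TO-LOCUS THROUGH A DYADIC `j`-WITNESS, and the PARITY-FREE dichotomy «one quadratic twist from
# the Fouquet–Wan locus ⟺ a j-witness» (cell `bsd-ssimc`, seat `bsd-ssimc-k3-c3` gen 4; a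
# `--supports … --as helper` file, closes nothing). Companion of `…LargeImageTwistToLocusPotMult.lean`
# (p439192), `…LargeImageTwistToLocus.lean` (p430776 + p432609), `…LargeImageOffLocusRam.lean` (p433235).

PARTITION (cell bsd-ssimc): X7 (A7) × the 23 (ram)-free off-FW-locus large-image window pairs (pieces
D ∪ E of MEMO-3 §T): after this file 13 = 11 (odd witness, p439192) + 2 (dyadic witness: 19600dd1@3,
`I₇^*` at 2; 99792cz1@5, `I₂^*` at 2) are one quadratic twist from the locus IN THE KERNEL, and the 10
without a `j`-witness are provably not — types-the-object-of; closes NONE. THEOREMS ONLY; no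
definition, no new named fact; nothing about any curve is asserted; FW stays PRE; BSD is not proved by
any of this.

## What this file records (namespace `Summit.BirchSwinnertonDyer.BirchSwinnertonDyer.Theorems`)

The `p*`-twist model of `AdditivePotMult/PStarTwistModel.lean` used in p439192 is for ODD primes. At
`r = 2` we argue directly from `ord₂ j(W) < 0`: SOME twist `W^{(e)}` is multiplicative at `2`
(`exists_twist_mult_of_padicValRat_j_neg`, Silverman *ATAEC* V.5.3); writing `e = d₀ t²` with `d₀` a
square-free integer (`Rat.exists_eq_squarefree_intCast_mul_sq`) the twist `W^{(d₀)}` is multiplicative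
at `2` as well, with globally minimal model `V`, `ord₂ Δ_min(V) = −ord₂ j(W)`. The remaining freedom is
a twist by an odd `u ≡ 1 (mod 4)` — UNRAMIFIED at `2` — which keeps `V` multiplicative at `2` with the
same `ord₂ Δ_min` and is split there iff (`2 ∣ (u−1)/4` ⟺ `V` split) (tree
`AdditivePotMult.hasMultiplicativeReductionAt_and_split_iff_quadraticTwist_two`, Kramer 1981 §2): we
take `u = c·q` with `c = p` if `p ∣ d₀` (so that the final parameter `d = (d₀/c)·q` is prime to `p`;
`d₀ u = c² d`) and `c = 1` otherwise, and `q` a Dirichlet prime with `c q ≡ 5` or `1 (mod 8)` according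
as `V` is split or not. Result: `exists_twist_on_fwLocus_of_jWitness_two`, and the parity-free
`exists_twist_on_fwLocus_of_offFwLocus_of_jWitness` — **«one quadratic twist from the Fouquet–Wan
locus ⟺ a j-witness», both directions in the kernel, no parity caveat** (the no-go half is
`not_fwLocus_model_twist_of_forall_dvd` of p439192). Off the locus the missing input is still TWIST
DESCENT (not claimed, not typed).

References: [FouquetWan2021] Thm 4.51 / 1.13 (PRE); [Kobayashi2003] Thm. 7.4, Conjecture (p. 2);
[SilvermanAEC2009] VII.5 Prop. 5.1, X.5 Cor. 5.4, VIII.8 Cor. 8.3, App. A Prop. A.1.1;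
[SilvermanATAEC1994] V.5.3; cell memos k3-c3 MEMO-3 §T, MEMO-5 (this gen).
-/

set_option autoImplicit false
set_option linter.dupNamespace false

noncomputable section

open scoped Classical

open WeierstrassCurve IsDedekindDomain NumberField Rat.HeightOneSpectrum
  Literature.NumberTheory.EllipticCurves
  Literature.NumberTheory.EllipticCurves.Rank1Residual
  Summit.BirchSwinnertonDyer.Rank1Residual.Supersingular

namespace Summit.BirchSwinnertonDyer.BirchSwinnertonDyer.Theorems

/-! ### §8 The unit twist `u ≡ 1 (mod 4)` at a multiplicative place over `2`, both parities -/

section TwistToLocusPotMultTwo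

variable (V W' : WeierstrassCurve ℚ) [V.IsElliptic] [V.IsGloballyMinimal] [W'.IsElliptic]
  [W'.IsGloballyMinimal]

/-- **Local part at `2`, both parities.** Let `C • W' = V^{(u)}` with `V, W'` globally minimal, `V`
multiplicative at the prime `ℓ = 2`, `u ≡ 1 (mod 4)`, and EITHER (`u ≡ 5 (mod 8)` and `V` split at `2`)
OR (`u ≡ 1 (mod 8)` and `V` non-split at `2`). Then `W'` is NON-SPLIT multiplicative at `2` with the
same `ord₂ Δ_min` (the unramified quadratic twist at `2`: tree `…_quadraticTwist_two`; type, splitness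
and `ord Δ_min` are `ℚ`-isomorphism invariants). Generalises gen 3's `nonsplit_of_smul_eq_quadraticTwist_two`
(the split case). [cite: SilvermanAEC2009, VII.5 Prop. 5.1(b), X.5 Cor. 5.4 and App. A Prop. A.1.1] -/
theorem nonsplit_of_smul_eq_quadraticTwist_two_of_emod_eight {u : ℤ} {C : VariableChange ℚ}
    (hC : C • W' = V.quadraticTwist (u : ℚ)) (ℓ : ℕ) [Fact ℓ.Prime] (hℓ : ℓ = 2)
    (hmult : V.HasMultiplicativeReductionAtPrime ℓ)
    (hu : (u % 8 = 5 ∧ V.HasSplitMultiplicativeReductionAtPrime ℓ) ∨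
      (u % 8 = 1 ∧ ¬ V.HasSplitMultiplicativeReductionAtPrime ℓ)) :
    W'.HasMultiplicativeReductionAtPrime ℓ ∧ ¬ W'.HasSplitMultiplicativeReductionAtPrime ℓ ∧
      padicValInt ℓ W'.minimalDiscriminantInt = padicValInt ℓ V.minimalDiscriminantInt := by
  have hu4 : u % 4 = 1 := by rcases hu with ⟨h, -⟩ | ⟨h, -⟩ <;> omega
  have hu0' : u ≠ 0 := by intro h; rw [h] at hu4; norm_num at hu4
  have hu0 : (u : ℚ) ≠ 0 := by exact_mod_cast hu0'
  haveI := V.isElliptic_quadraticTwist hu0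
  obtain ⟨v, rfl⟩ : ∃ v : HeightOneSpectrum (𝓞 ℚ), ((primesEquiv v : ℕ)) = ℓ :=
    ⟨primesEquiv.symm ⟨ℓ, Fact.out⟩, by rw [Equiv.apply_symm_apply]⟩
  have hVv : V.HasMultiplicativeReductionAt v :=
    (hasMultiplicativeReductionAtPrime_iff_hasMultiplicativeReductionAt_ringOfIntegers V v).mp hmult
  obtain ⟨hTm, hTord, hTs⟩ :=
    Summit.BirchSwinnertonDyer.Rank1Residual.AdditivePotMult.hasMultiplicativeReductionAt_and_split_iff_quadraticTwist_two
      (V := V) (v := v) hℓ hu4 hVv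
  have hW' : W' = C⁻¹ • V.quadraticTwist (u : ℚ) := by rw [← hC, inv_smul_smul]
  refine ⟨?_, ?_, ?_⟩
  · have h1 : W'.HasMultiplicativeReductionAt v := by
      rw [hW', hasMultiplicativeReductionAt_smul_iff_holds v _ C⁻¹]
      exact hTm
    exact (hasMultiplicativeReductionAtPrime_iff_hasMultiplicativeReductionAt_ringOfIntegers W' v).mpr h1
  · intro h'
    have h1 : W'.HasSplitMultiplicativeReductionAt v :=
      (hasSplitMultiplicativeReductionAtPrime_iff_hasSplitMultiplicativeReductionAt W' v).mp h'
    rw [hW', hasSplitMultiplicativeReductionAt_smul_iff_holds v _ C⁻¹] at h1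
    have h2 := hTs.mp h1
    rcases hu with ⟨h5, hVs⟩ | ⟨h1', hVns⟩
    · have hodd : ¬ (2 : ℤ) ∣ (u - 1) / 4 := by omega
      exact hodd (h2.mpr
        ((hasSplitMultiplicativeReductionAtPrime_iff_hasSplitMultiplicativeReductionAt V v).mp hVs))
    · have heven : (2 : ℤ) ∣ (u - 1) / 4 := by omega
      exact hVns ((hasSplitMultiplicativeReductionAtPrime_iff_hasSplitMultiplicativeReductionAt V v).mpr
        (h2.mp heven))
  · rw [← LocalTorsionMult.ordMinimalDiscriminant_eq_padicValInt W' v rfl,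
      ← LocalTorsionMult.ordMinimalDiscriminant_eq_padicValInt V v rfl, hW',
      ordMinimalDiscriminant_smul_holds v _ C⁻¹, hTord]

end TwistToLocusPotMultTwo

/-! ### §9 The dyadic `j`-witness and the parity-free dichotomy -/

section JWitnessTwo

variable (W : WeierstrassCurve ℚ) [W.IsElliptic] [W.IsGloballyMinimal]

/-- **Twist-to-locus through a DYADIC `j`-witness.** Let `W` be a globally minimal X7 pair at the odd
prime `p` with `a_p = 0`, `ρ̄_{E,p}` onto and no CM, and suppose `ord₂ j(W) < 0` with `p ∤ ord₂ j(W)`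
(`2` multiplicative or additive potentially multiplicative, Kodaira `I_n` / `I_n^*` with `p ∤ n`). Then
there are a square-free `d ∈ ℤ` prime to `p` and a globally minimal model `W'` of `W^{(d)}` which is an
X7 pair at `p` with `a_p = 0`, `ρ̄` onto, no CM, and lies ON the Fouquet–Wan locus AT `2` (non-split
multiplicative, `ord₂ Δ_min(W') = −ord₂ j(W)` prime to `p`). Steps: some `W^{(e)}` is multiplicative at
`2` (`exists_twist_mult_of_padicValRat_j_neg`); `e = d₀ t²` with `d₀` square-free
(`Rat.exists_eq_squarefree_intCast_mul_sq`), so `W^{(d₀)}` is, with globally minimal model `V`,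
`ord₂ Δ_min(V) = −ord₂ j(W)`; `c := p` if `p ∣ d₀` else `1`, `d₀ = c d₁`; a Dirichlet prime `q ≡ τ c
(mod 8)`, `τ = 5` if `V` is split at `2` else `1`, beyond `2 + p + |d₀| + |Δ_min(W)|`; `u := c q ≡ τ
(mod 8)`; `W'` a globally minimal model of `V^{(u)} ≅ W^{(d₀ u)} = W^{(d₁ q c²)} ≅ W^{(d)}`, `d = d₁ q`
square-free and prime to `p`; local conclusion by `nonsplit_of_smul_eq_quadraticTwist_two_of_emod_eight`;
X7 ∧ `a_p = 0` ∧ onto ∧ no CM along the square-free `d` (`p ∤ 2d`; additivity at `q`). A THEOREM.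
[cite: SilvermanATAEC1994, V.5.3] [cite: SilvermanAEC2009, VII.5 Prop. 5.1(b), X.5 Cor. 5.4 and VIII.8 Cor. 8.3] -/
theorem exists_twist_on_fwLocus_of_jWitness_two (p : ℕ) [Fact p.Prime] (hp : p ≠ 2)
    (hX : ClassX7 W p) (hcm : ¬ W.HasCM) (hap : W.frobeniusTrace p = 0) (hs : Surj W p)
    (hjneg : padicValRat 2 W.j < 0) (hj : ¬ (p : ℤ) ∣ padicValRat 2 W.j) :
    ∃ (d : ℤ) (W' : WeierstrassCurve ℚ) (_ : W'.IsElliptic) (_ : W'.IsGloballyMinimal)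
      (C : VariableChange ℚ), d ≠ 0 ∧ C • W' = W.quadraticTwist (d : ℚ) ∧
      ClassX7 W' p ∧ ¬ W'.HasCM ∧ W'.frobeniusTrace p = 0 ∧ Surj W' p ∧
      ((2 : ℕ) ≠ p ∧ W'.HasMultiplicativeReductionAtPrime 2 ∧
        ¬ W'.HasSplitMultiplicativeReductionAtPrime 2 ∧ ¬ p ∣ padicValInt 2 W'.minimalDiscriminantInt) := by
  have hpP : p.Prime := Fact.out
  have hpZ : Prime (p : ℤ) := Nat.prime_iff_prime_int.mp hpP
  have hp2' : (2 : ℕ) ≠ p := fun h ↦ hp h.symm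
  haveI : NeZero (2 : ℚ) := ⟨two_ne_zero⟩
  -- a square-free twist `W^{(d₀)}` multiplicative at `2`, with globally minimal model `V`
  obtain ⟨e, he0, hme⟩ :=
    Summit.BirchSwinnertonDyer.Rank1Residual.AdditivePotMult.exists_twist_mult_of_padicValRat_j_neg
      (W := W) hjneg
  obtain ⟨d₀, t, hd₀0, hd₀sq, ht0, hd₀e⟩ := Rat.exists_eq_squarefree_intCast_mul_sq he0
  have hd₀0' : ((d₀ : ℤ) : ℚ) ≠ 0 := by exact_mod_cast hd₀0
  haveI := W.isElliptic_quadraticTwist hd₀0'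
  haveI := W.isElliptic_quadraticTwist he0
  obtain ⟨C₃, hC₃⟩ := W.exists_variableChange_quadraticTwist_mul_sq (d₀ : ℚ) t ht0
  rw [hd₀e] at hC₃
  have hm₀ : Mult (W.quadraticTwist (d₀ : ℚ)) 2 := by
    rw [← hC₃] at hme
    exact (hasMultiplicativeReductionAtPrime_smul_iff (W.quadraticTwist (d₀ : ℚ)) C₃ 2).mp hme
  obtain ⟨V, iV, iVm, C₁, hC₁⟩ :=
    Summit.BirchSwinnertonDyer.Rank1Residual.AdditivePotMult.exists_globallyMinimal_model_twist W hd₀0'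
  have hVm : Mult V 2 :=
    Summit.BirchSwinnertonDyer.Rank1Residual.AdditivePotMult.mult_of_model_twist hd₀0' hm₀ ⟨C₁, hC₁⟩
  have hjV : V.j = W.j :=
    Summit.BirchSwinnertonDyer.Rank1Residual.AdditivePotMult.j_of_model_twist hd₀0' ⟨C₁, hC₁⟩
  have hordV : ¬ p ∣ padicValInt 2 V.minimalDiscriminantInt := by
    rw [Summit.BirchSwinnertonDyer.Rank1Residual.AdditivePotMult.dvd_padicValInt_minimalDiscriminantInt_iff_of_mult
      V 2 hVm p, hjV]
    exact hj
  -- remove `p` from `d₀`: `d₀ = c * d₁` with `c ∈ {1, p}` and `p ∤ d₁`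
  obtain ⟨c, d₁, hc, hcd, hpd₁⟩ : ∃ c d₁ : ℤ, (c = 1 ∨ c = p) ∧ d₀ = c * d₁ ∧ ¬ (p : ℤ) ∣ d₁ := by
    by_cases hpd : (p : ℤ) ∣ d₀
    · obtain ⟨d₁, hd₁⟩ := hpd
      refine ⟨p, d₁, Or.inr rfl, hd₁, fun h ↦ ?_⟩
      have hsq : (p : ℤ) * p ∣ d₀ := by rw [hd₁]; exact mul_dvd_mul_left _ h
      have hunit := hd₀sq _ hsq
      rw [Int.isUnit_iff_natAbs_eq, Int.natAbs_natCast] at hunit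
      exact hpP.ne_one hunit
    · exact ⟨1, d₀, Or.inl rfl, (one_mul _).symm, hpd⟩
  have hc0 : c ≠ 0 := by
    rcases hc with rfl | rfl
    · exact one_ne_zero
    · exact_mod_cast hpP.ne_zero
  have hcodd : c % 2 = 1 := by
    rcases hc with rfl | rfl
    · norm_num
    · have h2 : ¬ 2 ∣ p := fun h ↦ by
        rcases hpP.eq_one_or_self_of_dvd 2 h with h | h <;> omega
      omega
  have hc2 : c * c % 8 = 1 := by
    have hlt : c % 8 < 8 := Int.emod_lt_of_pos _ (by norm_num)
    have hge : 0 ≤ c % 8 := Int.emod_nonneg _ (by norm_num)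
    have hodd : c % 8 % 2 = 1 := by omega
    rw [Int.mul_emod]
    interval_cases h : c % 8 <;> omega
  have hd₁sq : Squarefree d₁ := by
    apply hd₀sq.squarefree_of_dvd
    exact ⟨c, by rw [hcd, mul_comm]⟩
  have hd₁0 : d₁ ≠ 0 := hd₁sq.ne_zero
  -- the target class `τ mod 8` (`5` to flip a split `V`, `1` to keep a non-split `V`) and `a ≡ τ c`
  set τ : ℤ := if V.HasSplitMultiplicativeReductionAtPrime 2 then 5 else 1 with hτ
  have hτ8 : τ % 8 = τ := by rw [hτ]; split_ifs <;> norm_num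
  have hτodd : τ % 2 = 1 := by rw [hτ]; split_ifs <;> norm_num
  set a : ℤ := τ * c % 8 with ha
  have ha_lt : a < 8 := Int.emod_lt_of_pos _ (by norm_num)
  have ha_ge : 0 ≤ a := Int.emod_nonneg _ (by norm_num)
  have ha_odd : a % 2 = 1 := by
    have h1 : τ * c % 2 = 1 := by rw [Int.mul_emod, hτodd, hcodd]; norm_num
    rw [ha, Int.emod_emod_of_dvd _ (by norm_num : (2 : ℤ) ∣ 8), h1]
  have ha_nat : ((a.toNat : ℕ) : ℤ) = a := Int.toNat_of_nonneg ha_ge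
  have hau : IsUnit ((a.toNat : ℕ) : ZMod 8) := by
    have h : a.toNat = 1 ∨ a.toNat = 3 ∨ a.toNat = 5 ∨ a.toNat = 7 := by omega
    rcases h with h | h | h | h <;> rw [h] <;> decide
  -- Dirichlet: a prime `q ≡ a (mod 8)` beyond `2`, `p`, `|d₀|`, `|Δ_min(W)|`
  obtain ⟨q, hqgt, hqP, hqa⟩ := Nat.forall_exists_prime_gt_and_eq_mod hau
    (2 + p + d₀.natAbs + W.minimalDiscriminantInt.natAbs)
  haveI : Fact q.Prime := ⟨hqP⟩
  have hq2 : q ≠ 2 := by omega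
  have hqp : q ≠ p := by omega
  have hq8 : (q : ℤ) % 8 = a := by
    have h := (ZMod.natCast_eq_natCast_iff' q a.toNat 8).mp hqa
    change q % 8 = a.toNat % 8 at h
    omega
  have hΔ0 : W.minimalDiscriminantInt ≠ 0 := minimalDiscriminantInt_ne_zero W
  have hqΔ : ¬ (q : ℤ) ∣ W.minimalDiscriminantInt := by
    intro h
    have h1 : q ∣ W.minimalDiscriminantInt.natAbs := Int.natCast_dvd.mp h
    have h2 := Nat.le_of_dvd (Int.natAbs_pos.mpr hΔ0) h1
    omega
  have hqgood : W.HasGoodReductionAtPrime q := hasGoodReductionAtPrime_of_not_dvd W q hqΔ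
  have hqd₀ : ¬ (q : ℤ) ∣ d₀ := by
    intro h
    have h1 : q ∣ d₀.natAbs := Int.natCast_dvd.mp h
    have h2 := Nat.le_of_dvd (Int.natAbs_pos.mpr hd₀0) h1
    omega
  have hqd₁ : ¬ (q : ℤ) ∣ d₁ := fun h ↦ hqd₀ (by rw [hcd]; exact dvd_mul_of_dvd_right h c)
  -- `u = c q ≡ τ (mod 8)` and the final parameter `d = d₁ q`
  set u : ℤ := c * q with hu_def
  have hu8 : u % 8 = τ := by
    have h1 : u % 8 = c % 8 * ((q : ℤ) % 8) % 8 := Int.mul_emod _ _ _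
    have h2 : c % 8 * (τ * c % 8) % 8 = c * (τ * c) % 8 := (Int.mul_emod _ _ _).symm
    have h3 : c * (τ * c) = τ * (c * c) := by ring
    rw [h1, hq8, ha, h2, h3, Int.mul_emod, hc2, mul_one, Int.emod_emod_of_dvd _ (dvd_refl 8), hτ8]
  have hu_cases : (u % 8 = 5 ∧ V.HasSplitMultiplicativeReductionAtPrime 2) ∨
      (u % 8 = 1 ∧ ¬ V.HasSplitMultiplicativeReductionAtPrime 2) := by
    by_cases hVs : V.HasSplitMultiplicativeReductionAtPrime 2
    · left; exact ⟨by rw [hu8, hτ, if_pos hVs], hVs⟩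
    · right; exact ⟨by rw [hu8, hτ, if_neg hVs], hVs⟩
  have hu0' : u ≠ 0 := mul_ne_zero hc0 (by exact_mod_cast hqP.ne_zero)
  have hu0 : (u : ℚ) ≠ 0 := by exact_mod_cast hu0'
  set d : ℤ := d₁ * q with hd_def
  have hd : Squarefree d := by
    rw [← Int.squarefree_natAbs]
    have habs : d.natAbs = d₁.natAbs * q := by rw [hd_def, Int.natAbs_mul, Int.natAbs_natCast]
    have hqd₁' : ¬ q ∣ d₁.natAbs := fun h ↦ hqd₁ (Int.natCast_dvd.mpr h)
    rw [habs, Nat.squarefree_mul (((Nat.Prime.coprime_iff_not_dvd hqP).mpr hqd₁').symm)]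
    exact ⟨Int.squarefree_natAbs.mpr hd₁sq, hqP.squarefree⟩
  have hd0' : d ≠ 0 := hd.ne_zero
  have hd0 : (d : ℚ) ≠ 0 := by exact_mod_cast hd0'
  have hpd : ¬ (p : ℤ) ∣ d := by
    intro h
    rw [hd_def] at h
    rcases hpZ.dvd_or_dvd h with h1 | h2
    · exact hpd₁ h1
    · exact hqp ((Nat.prime_dvd_prime_iff_eq hpP hqP).mp (by exact_mod_cast h2)).symm
  have hp2d : ¬ (p : ℤ) ∣ 2 * d := by
    intro h
    rcases hpZ.dvd_or_dvd h with h2 | h3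
    · exact hp ((Nat.prime_dvd_prime_iff_eq hpP Nat.prime_two).mp (by exact_mod_cast h2))
    · exact hpd h3
  have hqd : (q : ℤ) ∣ d := ⟨d₁, by rw [hd_def, mul_comm]⟩
  have hdu : ((d₀ : ℤ) : ℚ) * (u : ℚ) = (d : ℚ) * (c : ℚ) ^ 2 := by
    rw [hcd, hu_def, hd_def]; push_cast; ring
  -- a globally minimal model `W'` of `V^{(u)} ≅ W^{(d₀ u)} = W^{(d c²)} ≅ W^{(d)}`
  haveI := V.isElliptic_quadraticTwist hu0
  haveI := W.isElliptic_quadraticTwist hd0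
  obtain ⟨W', hE', hM', C₂, hC₂⟩ := exists_isGloballyMinimal_smul_eq_quadraticTwist V hu0
  obtain ⟨C₄, hC₄⟩ := W.exists_variableChange_quadraticTwist_mul_sq (d : ℚ) (c : ℚ)
    (by exact_mod_cast hc0)
  have hV : V = C₁ • W.quadraticTwist (d₀ : ℚ) := hC₁.symm
  have hVu : V.quadraticTwist (u : ℚ) =
      ((⟨C₁.u, (u : ℚ) * C₁.r, 0, 0⟩ : VariableChange ℚ) * C₄) • W.quadraticTwist (d : ℚ) := by
    rw [hV, quadraticTwist_smul, quadraticTwist_quadraticTwist, hdu, mul_smul, hC₄]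
  set D : VariableChange ℚ := (⟨C₁.u, (u : ℚ) * C₁.r, 0, 0⟩ : VariableChange ℚ) * C₄ with hD
  have hC : (D⁻¹ * C₂) • W' = W.quadraticTwist (d : ℚ) := by
    rw [mul_smul, hC₂, hVu, inv_smul_smul]
  have hW' : W' = (D⁻¹ * C₂)⁻¹ • W.quadraticTwist (d : ℚ) := by rw [← hC, inv_smul_smul]
  -- local conclusion at `2`
  obtain ⟨hm', hns', hord'⟩ :=
    nonsplit_of_smul_eq_quadraticTwist_two_of_emod_eight V W' hC₂ 2 rfl hVm hu_cases
  refine ⟨d, W', hE', hM', D⁻¹ * C₂, hd0', hC, ?_, ?_, ?_, ?_, hp2', hm', hns',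
    by rw [hord']; exact hordV⟩
  · exact ⟨goodSS_of_smul_eq_quadraticTwist W W' p hX.1 hd hC hp2d,
      not_semistable_of_smul_eq_quadraticTwist_of_odd_prime_dvd W W' hd hC hq2 hqd hqgood⟩
  · have hj' : W'.j = W.j := j_eq_of_model_smul_eq_quadraticTwist hd0 hC
    exact fun h ↦ hcm ((hasCM_iff_of_j_eq hj').mp h)
  · rw [frobeniusTrace_of_smul_eq_quadraticTwist W W' p hd hC hp2d hX.1.1, hap, mul_zero]
  · have h1 :=
      Summit.BirchSwinnertonDyer.Rank1Residual.GaloisImage.hasSurjectiveModNGaloisRep_pow_iff_of_model_twist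
        W p hd0 (Wd := W') ⟨(D⁻¹ * C₂)⁻¹, hW'.symm⟩ 1
    rw [pow_one] at h1
    exact h1.mpr hs

/-- **`stub_offFwLocus` hypotheses + ANY `j`-witness ⟹ a quadratic twist ON the Fouquet–Wan locus
(parity-free).** For `W` globally minimal, `p` odd, `ClassX7 W p`, no CM, `a_p = 0`, `ρ̄_{E,p}` onto,
OFF the FW locus (the registered stub's negated-locus hypothesis, verbatim), and a prime `r ≠ p` (odd
OR `2`) with `ord_r j(W) < 0` and `p ∤ ord_r j(W)`: there are `d ∈ ℤ ∖ {0}` and a globally minimal model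
`W'` of `W^{(d)}` that is an X7 pair at `p` with `a_p = 0`, `ρ̄` onto, no CM and satisfies the LOCUS
hypothesis of `stub_fwLocus` (`exists_twist_on_fwLocus_of_offFwLocus_of_jWitness_odd` for odd `r`,
`exists_twist_on_fwLocus_of_jWitness_two` for `r = 2`). With `not_fwLocus_model_twist_of_forall_dvd`:
«one quadratic twist from the FW locus ⟺ a `j`-witness». A THEOREM; nothing about Kobayashi's
conjecture is asserted. [cite: SilvermanATAEC1994, V.5.3] [cite: SilvermanAEC2009, VII.5 Prop. 5.1 and X.5 Cor. 5.4] -/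
theorem exists_twist_on_fwLocus_of_offFwLocus_of_jWitness (p : ℕ) [Fact p.Prime] (hp : p ≠ 2)
    (hX : ClassX7 W p) (hcm : ¬ W.HasCM) (hap : W.frobeniusTrace p = 0) (hs : Surj W p)
    (hoff : ¬ (∃ ℓ : ℕ, ∃ _ : Fact ℓ.Prime, ℓ ≠ p ∧ W.HasMultiplicativeReductionAtPrime ℓ ∧
      ¬ W.HasSplitMultiplicativeReductionAtPrime ℓ ∧ ¬ p ∣ padicValInt ℓ W.minimalDiscriminantInt))
    {r : ℕ} [Fact r.Prime] (hrp : r ≠ p) (hjneg : padicValRat r W.j < 0)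
    (hj : ¬ (p : ℤ) ∣ padicValRat r W.j) :
    ∃ (d : ℤ) (W' : WeierstrassCurve ℚ) (_ : W'.IsElliptic) (_ : W'.IsGloballyMinimal)
      (C : VariableChange ℚ), d ≠ 0 ∧ C • W' = W.quadraticTwist (d : ℚ) ∧
      ClassX7 W' p ∧ ¬ W'.HasCM ∧ W'.frobeniusTrace p = 0 ∧ Surj W' p ∧
      (∃ ℓ : ℕ, ∃ _ : Fact ℓ.Prime, ℓ ≠ p ∧ W'.HasMultiplicativeReductionAtPrime ℓ ∧
        ¬ W'.HasSplitMultiplicativeReductionAtPrime ℓ ∧ ¬ p ∣ padicValInt ℓ W'.minimalDiscriminantInt) := by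
  by_cases hr2 : r = 2
  · subst hr2
    obtain ⟨d, W', hE', hM', C, hd0, hC, hX', hcm', hap', hs', hloc⟩ :=
      exists_twist_on_fwLocus_of_jWitness_two W p hp hX hcm hap hs hjneg hj
    exact ⟨d, W', hE', hM', C, hd0, hC, hX', hcm', hap', hs', 2, inferInstance, hloc⟩
  · exact exists_twist_on_fwLocus_of_offFwLocus_of_jWitness_odd W p hp hX hcm hap hs hoff hr2 hrp
      hjneg hj

/-- **Modulo the Fouquet–Wan binder: `stub_offFwLocus` hypotheses + any `j`-witness ⟹ Kobayashi's
main conjecture for a quadratic twist, both signs** (parity-free). CONDITIONAL; no descent to `W` is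
claimed. [claim: FouquetWan2021, status: under-review] [cite: Kobayashi2003, Thm. 7.4 (p. 13) and Conjecture (p. 2)] -/
theorem exists_twist_kobayashiMainConjecture_of_thm451_OPEN_of_offFwLocus_of_jWitness
    (hFW : FouquetWan2021_thm451_via_kobayashi74_OPEN) (p : ℕ) [Fact p.Prime] (hp : p ≠ 2)
    (hX : ClassX7 W p) (hcm : ¬ W.HasCM) (hap : W.frobeniusTrace p = 0) (hs : Surj W p)
    (hoff : ¬ (∃ ℓ : ℕ, ∃ _ : Fact ℓ.Prime, ℓ ≠ p ∧ W.HasMultiplicativeReductionAtPrime ℓ ∧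
      ¬ W.HasSplitMultiplicativeReductionAtPrime ℓ ∧ ¬ p ∣ padicValInt ℓ W.minimalDiscriminantInt))
    {r : ℕ} [Fact r.Prime] (hrp : r ≠ p) (hjneg : padicValRat r W.j < 0)
    (hj : ¬ (p : ℤ) ∣ padicValRat r W.j) :
    ∃ (d : ℤ) (W' : WeierstrassCurve ℚ) (_ : W'.IsElliptic) (_ : W'.IsGloballyMinimal)
      (C : VariableChange ℚ), d ≠ 0 ∧ C • W' = W.quadraticTwist (d : ℚ) ∧
      ∀ ε : ℤˣ, KobayashiMainConjecture W' p ε := by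
  obtain ⟨d, W', hE', hM', C, hd0, hC, hX', -, hap', hs', hloc⟩ :=
    exists_twist_on_fwLocus_of_offFwLocus_of_jWitness W p hp hX hcm hap hs hoff hrp hjneg hj
  exact ⟨d, W', hE', hM', C, hd0, hC,
    X7.kobayashiMainConjecture_of_thm451_OPEN_of_surj W' p hFW hp hX' hap' hs' hloc⟩

end JWitnessTwo

end Summit.BirchSwinnertonDyer.BirchSwinnertonDyer.Theorems

end
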